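import Summits.AtomisticToContinuum.Crystallization.Theorems.FrustratedLawDichotomyStrainedPatchHomConvexSegment

/-!
# (I1) part E — the two 1-D EXPANSION FLOORS of the G5′ value leaf along a segment: second order with a CONSTANT curvature floor off a finite set
# (first edition, `…HomValueT2Kit`) and with a LINEARLY DECAYING floor `m₀ − L·t` (Lipschitz Hessian; second edition `…HomValueT2KitL`)
# (27623 `(H) HomFloor`, hcp half; decomp-a2c hand-1 g41; FINDING-hand-1-g41 §6 (R1)).

`g : [0,1] → ℝ` differentiable with `g′` continuous on `[0,1]` and differentiable off a finite set `X` (the regime junction parameters of the labels):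
* `expansion_floor`: `g″ ≥ m` off `X` ⟹ `g 1 ≥ g 0 + g′ 0 + m/2` (`…HomConvexSegment.monotoneOn_of_deriv_nonneg_off` ∘ `…HomConvexWell.tangentParabola_le`);
* `expansion_floor_lipschitz`: `g″ t ≥ m₀ − L·t` off `X` ⟹ `g 1 ≥ g 0 + g′ 0 + m₀/2 − L/6` (the tangent CUBIC).
No definitions; 0 sorry; standard axioms; no instances / notation / `#eval`.  `--supports stmt-AtomisticToContinuum-27623`.
-/

noncomputable section

namespace Summit.AtomisticToContinuum.Crystallization.Theorems.FrustratedLawDichotomyStrainedPatchHomValueT2Kit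

open Summit.AtomisticToContinuum.Crystallization.Theorems.FrustratedLawDichotomyStrainedPatchHomConvexWell (tangentParabola_le)
open Summit.AtomisticToContinuum.Crystallization.Theorems.FrustratedLawDichotomyStrainedPatchHomConvexSegment (le_of_deriv_nonneg_piece monotoneOn_of_deriv_nonneg_off)

/-- ★ **TANGENT CUBIC** (1-D).  If `g` has derivative `g′` on `[0,1]` and `g′ t ≥ g′ 0 + m₀ t − (L/2) t²` there, then `g 1 ≥ g 0 + g′ 0 + m₀/2 − L/6`.
[folklore: `h(t) = g t − g 0 − g′(0) t − m₀ t²/2 + L t³/6` has `h′ ≥ 0`] -/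
theorem tangentCubic_le {g g' : ℝ → ℝ} {m₀ L : ℝ} (hg : ∀ t ∈ Set.Icc (0 : ℝ) 1, HasDerivAt g (g' t) t)
    (hmono : ∀ t ∈ Set.Icc (0 : ℝ) 1, g' 0 + m₀ * t - L / 2 * t ^ 2 ≤ g' t) : g 0 + g' 0 + m₀ / 2 - L / 6 ≤ g 1 := by
  set h : ℝ → ℝ := fun t => g t - g 0 - g' 0 * t - m₀ * t ^ 2 / 2 + L * t ^ 3 / 6 with hh
  have hder : ∀ t ∈ Set.Icc (0 : ℝ) 1, HasDerivAt h (g' t - g' 0 - m₀ * t + L / 2 * t ^ 2) t := by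
    intro t ht
    have h1 := hg t ht
    have h2 : HasDerivAt (fun u : ℝ => g' 0 * u) (g' 0 * 1) t := (hasDerivAt_id t).const_mul (g' 0)
    have h3 : HasDerivAt (fun u : ℝ => m₀ * u ^ 2 / 2) (m₀ * ((2 : ℕ) * t ^ (2 - 1) * 1) / 2) t :=
      (((hasDerivAt_id t).pow 2).const_mul m₀).div_const 2
    have h4 : HasDerivAt (fun u : ℝ => L * u ^ 3 / 6) (L * ((3 : ℕ) * t ^ (3 - 1) * 1) / 6) t :=
      (((hasDerivAt_id t).pow 3).const_mul L).div_const 6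
    have h5 := (((h1.sub_const (g 0)).sub h2).sub h3).add h4
    refine h5.congr_deriv ?_
    push_cast
    ring
  have hcont : ContinuousOn h (Set.Icc 0 1) := fun t ht => (hder t ht).continuousAt.continuousWithinAt
  have hmvt := le_of_deriv_nonneg_piece (u := 0) (v := 1) zero_le_one hcont
    (fun t ht => hder t (Set.Ioo_subset_Icc_self ht)) (fun t ht => by have := hmono t (Set.Ioo_subset_Icc_self ht); linarith)
  have h0 : h 0 = 0 := by simp [hh]
  have h1 : h 1 = g 1 - g 0 - g' 0 - m₀ / 2 + L / 6 := by simp only [hh]; ring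
  rw [h0, h1] at hmvt
  linarith

/-- ★★ **SECOND-ORDER FLOOR WITH A CONSTANT CURVATURE BOUND OFF A FINITE SET**: `g′` continuous on `[0,1]`, `HasDerivAt g′ (g″ t) t` and `m ≤ g″ t` at every
`t ∈ (0,1) ∖ X` ⟹ `g 0 + g′ 0 + m/2 ≤ g 1`. [folklore] -/
theorem expansion_floor {g g' g'' : ℝ → ℝ} {m : ℝ} (X : Finset ℝ) (hg : ∀ t ∈ Set.Icc (0 : ℝ) 1, HasDerivAt g (g' t) t)
    (hg'c : ContinuousOn g' (Set.Icc (0 : ℝ) 1)) (hg'' : ∀ t ∈ Set.Ioo (0 : ℝ) 1, t ∉ X → HasDerivAt g' (g'' t) t)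
    (hm : ∀ t ∈ Set.Ioo (0 : ℝ) 1, t ∉ X → m ≤ g'' t) : g 0 + g' 0 + m / 2 ≤ g 1 := by
  -- `h(t) = g′ t − m t` is monotone on `[0,1]`
  have hcont : ContinuousOn (fun t => g' t - m * t) (Set.Icc (0 : ℝ) 1) := hg'c.sub (by fun_prop)
  have hmono := monotoneOn_of_deriv_nonneg_off (h := fun t => g' t - m * t) (h' := fun t => g'' t - m) (x := 0) (y := 1) X hcont
    (fun t ht hX => ((hg'' t ht hX).sub ((hasDerivAt_id t).const_mul m)).congr_deriv (by simp))
    (fun t ht hX => sub_nonneg.2 (hm t ht hX))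
  refine tangentParabola_le hg fun t ht => ?_
  have := hmono 0 t le_rfl ht.2 ht.1
  simp only [mul_zero, sub_zero] at this
  linarith

/-- ★★ **SECOND-ORDER FLOOR WITH A LINEARLY DECAYING CURVATURE BOUND (Lipschitz Hessian) OFF A FINITE SET**: `m₀ − L t ≤ g″ t` at every
`t ∈ (0,1) ∖ X` ⟹ `g 0 + g′ 0 + m₀/2 − L/6 ≤ g 1`. [folklore] -/
theorem expansion_floor_lipschitz {g g' g'' : ℝ → ℝ} {m₀ L : ℝ} (X : Finset ℝ) (hg : ∀ t ∈ Set.Icc (0 : ℝ) 1, HasDerivAt g (g' t) t)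
    (hg'c : ContinuousOn g' (Set.Icc (0 : ℝ) 1)) (hg'' : ∀ t ∈ Set.Ioo (0 : ℝ) 1, t ∉ X → HasDerivAt g' (g'' t) t)
    (hm : ∀ t ∈ Set.Ioo (0 : ℝ) 1, t ∉ X → m₀ - L * t ≤ g'' t) : g 0 + g' 0 + m₀ / 2 - L / 6 ≤ g 1 := by
  -- `h(t) = g′ t − m₀ t + (L/2) t²` is monotone on `[0,1]`
  have hcont : ContinuousOn (fun t => g' t - m₀ * t + L / 2 * t ^ 2) (Set.Icc (0 : ℝ) 1) := (hg'c.sub (by fun_prop)).add (by fun_prop)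
  have hmono := monotoneOn_of_deriv_nonneg_off (h := fun t => g' t - m₀ * t + L / 2 * t ^ 2) (h' := fun t => g'' t - m₀ + L * t)
    (x := 0) (y := 1) X hcont
    (fun t ht hX => by
      have h3 : HasDerivAt (fun u : ℝ => L / 2 * u ^ 2) (L / 2 * ((2 : ℕ) * t ^ (2 - 1) * 1)) t := ((hasDerivAt_id t).pow 2).const_mul (L / 2)
      exact (((hg'' t ht hX).sub ((hasDerivAt_id t).const_mul m₀)).add h3).congr_deriv (by push_cast; ring))
    (fun t ht hX => by have := hm t ht hX; show 0 ≤ g'' t - m₀ + L * t; linarith)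
  refine tangentCubic_le hg fun t ht => ?_
  have := hmono 0 t le_rfl ht.2 ht.1
  simp only [mul_zero, sub_zero] at this
  norm_num at this
  linarith

end Summit.AtomisticToContinuum.Crystallization.Theorems.FrustratedLawDichotomyStrainedPatchHomValueT2Kit
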